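import Summits.NavierStokesRegularity.NavierStokesRegularity.Theorems.PerpetualPumpAveragedTypeIBlowupPulseClock
import Summits.NavierStokesRegularity.NavierStokesRegularity.Theorems.PerpetualPumpAveragedTypeIBlowupPulseAlgebra
import Summits.NavierStokesRegularity.NavierStokesRegularity.Theorems.PerpetualPumpAveragedTypeIBlowupPulseDead

/-!
# Crux `PerpetualPump.AveragedTypeIBlowup` (stmt-NavierStokesRegularity-1835), line `Sketch`:
# tools for the stub `pulse`, IV — the second half of the clock and the exit of the gate phase

Fourth layer of the proof of the registered stub `stub_pulse` (the TRANSFER PULSE of the forced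
Toda gate), continuing `…PulseTools.lean`, `…PulseGate.lean`, `…PulseClock.lean`,
`…PulseAlgebra.lean`, `…PulseDead.lean`. `[0, T]` is a gate phase (`w ≥ 1`, `B T ≤ 5 log B + 20`),
`R = √((b-β)² + 2w²)`, `u = (b-β)/R`, `K = 49B/50`, `t₁ = log (128 B)/K`, `t₂ = log (2B)/K`,
`t₃ = log B/K`.

* `pulse_gate_secondhalf` — after the first zero `σm` of the clock: `u ≤ 0` (barrier),
  `1 + u ≤ e^{-K(σ-σm)} + ψ/K` (damped comparison), so from `σm + t₂` on `β' < 0` and the bond is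
  damped at rate `K`; hence `T < σm + t₂ + t₃`.
* `pulse_gate_atT`, `pulse_gate_exit` (= registered sub-goal `stub_pulseExit`) — the exit data of a gate phase ending at `w T = 1`:
  `σm ≤ min (T, t₁)`, the first-half integral bound, `β' < 0` on `[σm + t₂, T]`, `T < σm + t₂ + t₃`,
  `B T ≤ (50/49)(8 log 2 + 3 log B)`, `u T ≤ 0`, `b T ≤ 83/5000`,
  `β T ≥ B - 1/50 - 1.1111 B T - 10⁻⁴ ≥ 0.996 B`.

## References

Folklore ODE comparison arguments; the gate is the Toda-type transfer step of T. Tao, *Finite time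
blowup for an averaged three-dimensional Navier–Stokes equation*, J. Amer. Math. Soc. 29 (2016),
601–674, §5.4–5.5.
-/

noncomputable section

-- the summit namespace `…NavierStokesRegularity.NavierStokesRegularity…` is the tree convention
set_option linter.dupNamespace false

open MeasureTheory Set Filter Topology

namespace Summit.NavierStokesRegularity.NavierStokesRegularity.Theorems.PerpetualPumpAveragedTypeIBlowup

set_option maxHeartbeats 400000 in
/-- **The gate phase, V: second half of the clock.** After the first zero `σm` of the clock:
`u ≤ 0` on `[σm, T]` (barrier), `1 + u ≤ e^{-(49B/50)(σ - σm)} + ψ/K` (damped comparison for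
`(1+u)' ≤ -(49B/50)(1+u) + ψ`), hence from `σm + t₂` on, `t₂ = log (2B)/(49B/50)`, the clock sits at
`1 + u ≤ 0.5002/B`, where `β' < 0` and `b - β - 1 ≤ -49B/50` (`pulse_alg_late`); in particular the
bond decays like `e^{-(49B/50) t}` there, which is incompatible with `w ≥ 1` after a further
`t₃ = log B/(49B/50)`: `T < σm + t₂ + t₃`. [folklore] -/
theorem pulse_gate_secondhalf (b w β f₁ f₂ f₃ R u : ℝ → ℝ) (B q4 φ σ₁ T : ℝ)
    (hB : 10 ^ 4 ≤ B) (hq1 : 1 ≤ q4) (hq2 : q4 ≤ 111 / 100) (hφ0 : 0 ≤ φ) (hφ1 : φ ≤ 1 / 2000)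
    (hσ₁ : σ₁ ≤ 1 / 10)
    (hbc : ContinuousOn b (Icc 0 σ₁)) (hwc : ContinuousOn w (Icc 0 σ₁))
    (hβc : ContinuousOn β (Icc 0 σ₁))
    (hbd : ∀ σ ∈ Ioo 0 σ₁, HasDerivAt b (-(b σ) - (w σ) ^ 2 + f₁ σ) σ)
    (hwd : ∀ σ ∈ Ioo 0 σ₁, HasDerivAt w (w σ * (b σ - β σ - 1) + f₂ σ) σ)
    (hβd : ∀ σ ∈ Ioo 0 σ₁, HasDerivAt β (-(q4 * β σ) + (w σ) ^ 2 + f₃ σ) σ)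
    (hf : ∀ σ ∈ Icc 0 σ₁, |f₁ σ| ≤ φ ∧ |f₂ σ| ≤ φ ∧ |f₃ σ| ≤ φ)
    (hb0 : b 0 = B) (hw0 : w 0 = Real.sqrt B / 10) (hβ0 : |β 0| ≤ 1 / 50)
    (hR : R = fun s => Real.sqrt ((b s - β s) ^ 2 + 2 * (w s) ^ 2))
    (hu : u = fun s => (b s - β s) / R s)
    (hT0 : 0 < T) (hT1 : T ≤ σ₁) (hTB : B * T ≤ 5 * Real.log B + 20)
    (hw1 : ∀ σ ∈ Icc 0 T, 1 ≤ w σ)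
    {σm : ℝ} (hσm0 : 0 < σm) (hum : u σm = 0) :
    (∀ σ ∈ Icc σm T, u σ ≤ 0 ∧
      1 + u σ ≤ Real.exp (-(49 * B / 50 * (σ - σm))) + 1 / (1000 * B) / (49 * B / 50)) ∧
    (∀ σ ∈ Icc (σm + Real.log (2 * B) / (49 * B / 50)) T,
      -(q4 * β σ) + (w σ) ^ 2 + f₃ σ < 0 ∧ b σ - β σ - 1 ≤ -(49 * B / 50)) ∧
    T < σm + Real.log (2 * B) / (49 * B / 50) + Real.log B / (49 * B / 50) := by
  have hB0 : 0 < B := lt_of_lt_of_le (by norm_num) hB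
  obtain ⟨-, huc, -, hRb⟩ := pulse_gate_radius b w β f₁ f₂ f₃ R u B q4 φ σ₁ T hB hq1 hq2 hφ0 hφ1 hσ₁ hbc hwc hβc hbd hwd hβd hf hb0 hw0 hβ0 hR hu hT0 hT1 hTB hw1
  obtain ⟨hclock, hcl⟩ := pulse_gate_clock b w β f₁ f₂ f₃ R u B q4 φ σ₁ T hB hq1 hq2 hφ0 hφ1 hσ₁ hbc hwc hβc hbd hwd hβd hf hb0 hw0 hβ0 hR hu hT0 hT1 hTB hw1
  have hRs : ∀ s, Real.sqrt ((b s - β s) ^ 2 + 2 * (w s) ^ 2) = R s := fun s => by rw [hR]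
  have hus : ∀ s, u s = (b s - β s) / R s := fun s => by rw [hu]
  have hK0 : (0 : ℝ) < 49 * B / 50 := by positivity
  have hmT : Icc σm T ⊆ Icc 0 T := Icc_subset_Icc_left hσm0.le
  -- `u ≤ 0` on `[σm, T]`
  have hule : ∀ σ ∈ Icc σm T, u σ ≤ 0 := by
    refine pulse_barrier_upper (huc.mono hmT) hum.le (fun s hs hpos => ?_)
    obtain ⟨u', hu', hle⟩ := hclock s ⟨hσm0.trans hs.1, hs.2⟩
    obtain ⟨hub, -⟩ := hcl s ⟨(hσm0.trans hs.1).le, hs.2.le⟩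
    refine ⟨u', hu', ?_⟩
    have h00 : (0 : ℝ) < 1 / (202 * B) := by positivity
    have h0 : (1 - u s) * 1 ≤ (1 - u s) * (1 + u s) :=
      mul_le_mul_of_nonneg_left (by linarith) (by linarith)
    have h1 : 1 / (202 * B) ≤ 1 - u s ^ 2 := by nlinarith
    have h2 : 49 * B / 50 * (1 / (202 * B)) ≤ 49 * B / 50 * (1 - u s ^ 2) :=
      mul_le_mul_of_nonneg_left h1 hK0.le
    have e : 49 * B / 50 * (1 / (202 * B)) = 49 / 10100 := by field_simp; norm_num
    have h3 : 1 / (1000 * B) ≤ 1 / 10000000 := by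
      rw [one_div_le_one_div (by positivity) (by norm_num)]; linarith
    linarith
  -- damped comparison for `v = 1 + u`
  have hv : ∀ σ ∈ Icc σm T,
      1 + u σ ≤ 1 * Real.exp (-(49 * B / 50 * (σ - σm))) + 1 / (1000 * B) / (49 * B / 50) := by
    refine pulse_decay_le (x := fun s => 1 + u s) hK0 (by positivity)
      (continuousOn_const.add (huc.mono hmT)) (by rw [hum]; norm_num) zero_le_one
      (fun s hs _ => ?_)
    obtain ⟨u', hu', hle⟩ := hclock s ⟨hσm0.trans hs.1, hs.2⟩
    refine ⟨u', hu'.const_add 1, ?_⟩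
    have hus0 := hule s (Ioo_subset_Icc_self hs)
    obtain ⟨-, -, -, hu1, -⟩ := pulse_gate_point
      (by linarith [hw1 s (hmT (Ioo_subset_Icc_self hs))]) (hRs s) (hus s)
    have h1 : 49 * B / 50 * (1 + u s) ≤ 49 * B / 50 * (1 - u s ^ 2) := by
      apply mul_le_mul_of_nonneg_left _ hK0.le
      nlinarith
    linarith
  have hpart1 : ∀ σ ∈ Icc σm T, u σ ≤ 0 ∧
      1 + u σ ≤ Real.exp (-(49 * B / 50 * (σ - σm))) + 1 / (1000 * B) / (49 * B / 50) :=
    fun σ hσ => ⟨hule σ hσ, by simpa only [one_mul] using hv σ hσ⟩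
  -- after `t₂`: `1 + u ≤ 0.5002/B`
  have hψK : 1 / (1000 * B) / (49 * B / 50) ≤ 1 / (10000 * B) := by
    rw [div_div, one_div_le_one_div (by positivity) (by positivity)]
    nlinarith
  have hlate : ∀ σ ∈ Icc (σm + Real.log (2 * B) / (49 * B / 50)) T,
      1 + u σ ≤ 5002 / 10000 / B := by
    intro σ hσ
    have ht₂0 : 0 ≤ Real.log (2 * B) / (49 * B / 50) :=
      div_nonneg (Real.log_nonneg (by linarith)) hK0.le
    have hσm' : σ ∈ Icc σm T := ⟨by linarith [hσ.1], hσ.2⟩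
    have h1 := (hpart1 σ hσm').2
    have h2 : Real.exp (-(49 * B / 50 * (σ - σm))) ≤ Real.exp (-(49 * B / 50 * (Real.log (2 * B) / (49 * B / 50)))) := by
      apply Real.exp_le_exp.2
      have : 49 * B / 50 * (Real.log (2 * B) / (49 * B / 50)) ≤ 49 * B / 50 * (σ - σm) :=
        mul_le_mul_of_nonneg_left (by linarith [hσ.1]) hK0.le
      linarith
    rw [mul_div_cancel₀ _ hK0.ne', Real.exp_neg (Real.log (2 * B)), Real.exp_log (by positivity)] at h2
    have e1 : (2 * B)⁻¹ = 5000 / 10000 / B := by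
      field_simp; norm_num
    have e2 : 1 / (10000 * B) = 1 / 10000 / B := by rw [div_div]
    have e3 : 5000 / 10000 / B + 1 / 10000 / B ≤ 5002 / 10000 / B := by
      rw [← add_div]; exact div_le_div_of_nonneg_right (by norm_num) hB0.le
    linarith
  have hpart2 : ∀ σ ∈ Icc (σm + Real.log (2 * B) / (49 * B / 50)) T,
      -(q4 * β σ) + (w σ) ^ 2 + f₃ σ < 0 ∧ b σ - β σ - 1 ≤ -(49 * B / 50) := by
    intro σ hσ
    have ht₂0 : 0 ≤ Real.log (2 * B) / (49 * B / 50) :=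
      div_nonneg (Real.log_nonneg (by linarith)) hK0.le
    have hσT : σ ∈ Icc 0 T := ⟨by linarith [hσ.1], hσ.2⟩
    obtain ⟨hR1, hR2, -⟩ := hRb σ hσT
    obtain ⟨-, ⟨hXlo, -⟩, -⟩ := hcl σ hσT
    obtain ⟨-, -, hD, hu1, -, hw2, -⟩ := pulse_gate_point (by linarith [hw1 σ hσT]) (hRs σ) (hus σ)
    obtain ⟨-, -, h3⟩ := hf σ ⟨hσT.1, hσT.2.trans hT1⟩
    exact pulse_alg_late hB hq1 ((abs_le.1 h3).2.trans hφ1) hR1 hR2 hD hw2 hXlo hu1 (hlate σ hσ)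
  refine ⟨hpart1, hpart2, ?_⟩
  -- exit: `w` would drop below `1` at `σm + t₂ + t₃`
  by_contra! hT3
  set a : ℝ := σm + Real.log (2 * B) / (49 * B / 50) with ha
  have ht₂0 : 0 ≤ Real.log (2 * B) / (49 * B / 50) :=
    div_nonneg (Real.log_nonneg (by linarith)) hK0.le
  have ht₃0 : 0 ≤ Real.log B / (49 * B / 50) := div_nonneg (Real.log_nonneg (by linarith)) hK0.le
  have ha0 : 0 ≤ a := by rw [ha]; linarith
  have haT : a ≤ T := by rw [ha]; linarith
  have haI : Icc a T ⊆ Icc 0 σ₁ := fun s hs => ⟨ha0.trans hs.1, hs.2.trans hT1⟩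
  have hdec := pulse_decay_abs (x := w) (k := fun s => b s - β s - 1) (f := f₂) (K := 49 * B / 50)
    (a := a) (c := T) hK0 hφ0 (hwc.mono haI)
    (fun s hs => hwd s ⟨ha0.trans_lt hs.1, hs.2.trans_le hT1⟩)
    (fun s hs => (hpart2 s ⟨hs.1.le, hs.2.le⟩).2)
    (fun s hs => (hf s (haI (Ioo_subset_Icc_self hs))).2.1)
    (a + Real.log B / (49 * B / 50)) ⟨by linarith, hT3⟩
  -- `|w a| ≤ 0.99 B`
  have hwa : |w a| ≤ 99 / 100 * B := by
    have haT' : a ∈ Icc 0 T := ⟨ha0, haT⟩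
    obtain ⟨hR1, hR2, -⟩ := hRb a haT'
    obtain ⟨hRpos, -, hD, hu1, -, hw2, -⟩ := pulse_gate_point (by linarith [hw1 a haT']) (hRs a) (hus a)
    have hv := hlate a ⟨le_rfl, haT⟩
    refine abs_le_of_sq_le_sq ?_ (by positivity)
    have h1 : 2 * (w a) ^ 2 ≤ R a ^ 2 * (2 * (1 + u a)) := by
      rw [hw2]
      apply mul_le_mul_of_nonneg_left _ (by positivity)
      nlinarith
    have h2 : R a ^ 2 * (2 * (1 + u a)) ≤ (1001 / 1000 * B) ^ 2 * (2 * (5002 / 10000 / B)) :=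
      mul_le_mul (pow_le_pow_left₀ hRpos.le hR2 2) (by linarith) (by linarith) (by positivity)
    have e : (1001 / 1000 * B) ^ 2 * (2 * (5002 / 10000 / B)) =
        1001 ^ 2 * 5002 * 2 / (10 ^ 10) * B := by
      field_simp
      ring
    nlinarith
  rw [add_sub_cancel_left, mul_div_cancel₀ _ hK0.ne', Real.exp_neg (Real.log B), Real.exp_log hB0] at hdec
  have h1 : |w a| * B⁻¹ ≤ 99 / 100 := by
    rw [← div_eq_mul_inv, div_le_iff₀ hB0]; exact hwa
  have h2 : φ / (49 * B / 50) ≤ 1 / 1000 := by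
    rw [div_le_iff₀ hK0]; nlinarith
  have h3 := hw1 (a + Real.log B / (49 * B / 50)) ⟨by linarith, hT3⟩
  have h4 := le_abs_self (w (a + Real.log B / (49 * B / 50)))
  linarith

/-- **The gate phase, VI: the state when the bond has decayed to `w = 1`.** If `w T = 1` at the
end of a gate phase, then the clock is past noon (`u T ≤ 0`, in fact `1 + u T = O(B⁻²)`), the old
carrier is small (`b T ≤ 83/5000`) and the new one carries everything:
`β T ≥ (P + R)/2 - 10⁻⁴ ≥ B - 1/50 - 1.1111 B T - 10⁻⁴` (`pulse_alg_atT`). [folklore] -/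
theorem pulse_gate_atT (b w β f₁ f₂ f₃ R u : ℝ → ℝ) (B q4 φ σ₁ T : ℝ)
    (hB : 10 ^ 4 ≤ B) (hq1 : 1 ≤ q4) (hq2 : q4 ≤ 111 / 100) (hφ0 : 0 ≤ φ) (hφ1 : φ ≤ 1 / 2000)
    (hσ₁ : σ₁ ≤ 1 / 10)
    (hbc : ContinuousOn b (Icc 0 σ₁)) (hwc : ContinuousOn w (Icc 0 σ₁))
    (hβc : ContinuousOn β (Icc 0 σ₁))
    (hbd : ∀ σ ∈ Ioo 0 σ₁, HasDerivAt b (-(b σ) - (w σ) ^ 2 + f₁ σ) σ)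
    (hwd : ∀ σ ∈ Ioo 0 σ₁, HasDerivAt w (w σ * (b σ - β σ - 1) + f₂ σ) σ)
    (hβd : ∀ σ ∈ Ioo 0 σ₁, HasDerivAt β (-(q4 * β σ) + (w σ) ^ 2 + f₃ σ) σ)
    (hf : ∀ σ ∈ Icc 0 σ₁, |f₁ σ| ≤ φ ∧ |f₂ σ| ≤ φ ∧ |f₃ σ| ≤ φ)
    (hb0 : b 0 = B) (hw0 : w 0 = Real.sqrt B / 10) (hβ0 : |β 0| ≤ 1 / 50)
    (hR : R = fun s => Real.sqrt ((b s - β s) ^ 2 + 2 * (w s) ^ 2))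
    (hu : u = fun s => (b s - β s) / R s)
    (hT0 : 0 < T) (hT1 : T ≤ σ₁) (hTB : B * T ≤ 5 * Real.log B + 20)
    (hw1 : ∀ σ ∈ Icc 0 T, 1 ≤ w σ)
    (hwT : w T = 1) :
    u T ≤ 0 ∧ b T ≤ 83 / 5000 ∧ B - 1 / 50 - 11111 / 10000 * B * T - 1 / 10000 ≤ β T := by
  obtain ⟨-, -, -, hRb⟩ := pulse_gate_radius b w β f₁ f₂ f₃ R u B q4 φ σ₁ T hB hq1 hq2 hφ0 hφ1 hσ₁ hbc hwc hβc hbd hwd hβd hf hb0 hw0 hβ0 hR hu hT0 hT1 hTB hw1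
  obtain ⟨-, hcl⟩ := pulse_gate_clock b w β f₁ f₂ f₃ R u B q4 φ σ₁ T hB hq1 hq2 hφ0 hφ1 hσ₁ hbc hwc hβc hbd hwd hβd hf hb0 hw0 hβ0 hR hu hT0 hT1 hTB hw1
  have hTT : T ∈ Icc 0 T := right_mem_Icc.2 hT0.le
  obtain ⟨hR1, hR2, hR3⟩ := hRb T hTT
  obtain ⟨hub, ⟨-, hXhi⟩, -⟩ := hcl T hTT
  obtain ⟨-, -, hD, hu1, -, hw2, -⟩ := pulse_gate_point (by linarith [hw1 T hTT])
    (show Real.sqrt ((b T - β T) ^ 2 + 2 * (w T) ^ 2) = R T by rw [hR])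
    (show u T = (b T - β T) / R T by rw [hu])
  rw [hwT] at hw2
  obtain ⟨h1, h2, h3⟩ := pulse_alg_atT hB hR1 hR2 hw2 hu1 hub hXhi hD
  obtain ⟨-, -, -, -, -, hPlo⟩ := pulse_envelope_energy b w β f₁ f₂ f₃ B q4 φ σ₁ hB hq1 hq2 hφ0 hφ1
    hσ₁ hbc hwc hβc hbd hwd hβd hf hb0 hw0 hβ0 T ⟨hT0.le, hT1⟩
  have hB0 : 0 < B := lt_of_lt_of_le (by norm_num) hB
  have hBT : 0 ≤ B * T := by positivity
  exact ⟨h1, h2, by nlinarith⟩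

/-- **The gate phase, VII: summary when the bond exits at `w T = 1`.** The clock passes noon at
some `σm ≤ min (T, t₁)`, the a-priori integral bound of the first half and the sign of `β'` after
`σm + t₂` hold, `T < σm + t₂ + t₃`, hence `B T ≤ (50/49)(8 log 2 + 3 log B)` and at the exit
`u T ≤ 0`, `b T ≤ 83/5000`, `β T ≥ 0.996 B`
(`t₁, t₂, t₃ = log (128 B), log (2B), log B` over `49B/50`). [folklore] -/
theorem pulse_gate_exit (b w β f₁ f₂ f₃ R u : ℝ → ℝ) (B q4 φ σ₁ T : ℝ)
    (hB : 10 ^ 4 ≤ B) (hq1 : 1 ≤ q4) (hq2 : q4 ≤ 111 / 100) (hφ0 : 0 ≤ φ) (hφ1 : φ ≤ 1 / 2000)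
    (hσ₁ : σ₁ ≤ 1 / 10)
    (hbc : ContinuousOn b (Icc 0 σ₁)) (hwc : ContinuousOn w (Icc 0 σ₁))
    (hβc : ContinuousOn β (Icc 0 σ₁))
    (hbd : ∀ σ ∈ Ioo 0 σ₁, HasDerivAt b (-(b σ) - (w σ) ^ 2 + f₁ σ) σ)
    (hwd : ∀ σ ∈ Ioo 0 σ₁, HasDerivAt w (w σ * (b σ - β σ - 1) + f₂ σ) σ)
    (hβd : ∀ σ ∈ Ioo 0 σ₁, HasDerivAt β (-(q4 * β σ) + (w σ) ^ 2 + f₃ σ) σ)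
    (hf : ∀ σ ∈ Icc 0 σ₁, |f₁ σ| ≤ φ ∧ |f₂ σ| ≤ φ ∧ |f₃ σ| ≤ φ)
    (hb0 : b 0 = B) (hw0 : w 0 = Real.sqrt B / 10) (hβ0 : |β 0| ≤ 1 / 50)
    (hR : R = fun s => Real.sqrt ((b s - β s) ^ 2 + 2 * (w s) ^ 2))
    (hu : u = fun s => (b s - β s) / R s)
    (hT0 : 0 < T) (hT1 : T ≤ σ₁) (hTB : B * T ≤ 5 * Real.log B + 20)
    (hw1 : ∀ σ ∈ Icc 0 T, 1 ≤ w σ)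
    (hwT : w T = 1) :
    ∃ σm : ℝ, 0 < σm ∧ σm ≤ T ∧
      49 * B / 50 * ∫ σ in (0 : ℝ)..σm, (1 - u σ) ≤ 1 + T / (1000 * B) ∧
      (∀ σ ∈ Icc (σm + Real.log (2 * B) / (49 * B / 50)) T,
        -(q4 * β σ) + (w σ) ^ 2 + f₃ σ < 0) ∧
      T < σm + Real.log (2 * B) / (49 * B / 50) + Real.log B / (49 * B / 50) ∧
      B * T ≤ 50 / 49 * (8 * Real.log 2 + 3 * Real.log B) ∧
      u T ≤ 0 ∧ b T ≤ 83 / 5000 ∧ B - 1 / 50 - 11111 / 10000 * B * T - 1 / 10000 ≤ β T ∧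
      996 / 1000 * B ≤ β T := by
  have hB0 : 0 < B := lt_of_lt_of_le (by norm_num) hB
  have hK0 : (0 : ℝ) < 49 * B / 50 := by positivity
  obtain ⟨huT, hbT, hβT⟩ := pulse_gate_atT b w β f₁ f₂ f₃ R u B q4 φ σ₁ T hB hq1 hq2 hφ0 hφ1 hσ₁ hbc hwc hβc hbd hwd hβd hf hb0 hw0 hβ0 hR hu hT0 hT1 hTB hw1 hwT
  -- the first zero of the clock, before `min T t₁`
  obtain ⟨σm, hσm0, hσmT, hσmt₁, hum, hint⟩ : ∃ σm : ℝ, 0 < σm ∧ σm ≤ T ∧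
      σm ≤ Real.log (128 * B) / (49 * B / 50) ∧ u σm = 0 ∧
      49 * B / 50 * ∫ σ in (0 : ℝ)..σm, (1 - u σ) ≤ 1 + T / (1000 * B) := by
    by_cases ht₁ : Real.log (128 * B) / (49 * B / 50) ≤ T
    · obtain ⟨s, hs, hus0⟩ := pulse_gate_reach b w β f₁ f₂ f₃ R u B q4 φ σ₁ T hB hq1 hq2 hφ0 hφ1 hσ₁ hbc hwc hβc hbd hwd hβd hf hb0 hw0 hβ0 hR hu hT0 hT1 hTB hw1 ht₁
      obtain ⟨σm, hσm, hum, -, hint⟩ := pulse_gate_firsthalf b w β f₁ f₂ f₃ R u B q4 φ σ₁ T hB hq1 hq2 hφ0 hφ1 hσ₁ hbc hwc hβc hbd hwd hβd hf hb0 hw0 hβ0 hR hu hT0 hT1 hTB hw1 ⟨hs.1, hs.2.trans ht₁⟩ hus0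
      exact ⟨σm, hσm.1, hσm.2.trans (hs.2.trans ht₁), hσm.2.trans hs.2, hum, hint⟩
    · obtain ⟨σm, hσm, hum, -, hint⟩ := pulse_gate_firsthalf b w β f₁ f₂ f₃ R u B q4 φ σ₁ T hB hq1 hq2 hφ0 hφ1 hσ₁ hbc hwc hβc hbd hwd hβd hf hb0 hw0 hβ0 hR hu hT0 hT1 hTB hw1 (right_mem_Icc.2 hT0.le) huT
      exact ⟨σm, hσm.1, hσm.2, by linarith [hσm.2], hum, hint⟩
  obtain ⟨-, hpart2, hT3⟩ := pulse_gate_secondhalf b w β f₁ f₂ f₃ R u B q4 φ σ₁ T hB hq1 hq2 hφ0 hφ1 hσ₁ hbc hwc hβc hbd hwd hβd hf hb0 hw0 hβ0 hR hu hT0 hT1 hTB hw1 hσm0 hum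
  -- the time budget
  have hlog128 : Real.log (128 * B) = 7 * Real.log 2 + Real.log B := by
    rw [Real.log_mul (by norm_num) hB0.ne', show (128 : ℝ) = 2 ^ 7 by norm_num, Real.log_pow]
    push_cast
    ring
  have hlog2B : Real.log (2 * B) = Real.log 2 + Real.log B := Real.log_mul (by norm_num) hB0.ne'
  have hBT : B * T ≤ 50 / 49 * (8 * Real.log 2 + 3 * Real.log B) := by
    have h1 : T ≤ (8 * Real.log 2 + 3 * Real.log B) / (49 * B / 50) := by
      have e : (8 * Real.log 2 + 3 * Real.log B) / (49 * B / 50) =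
          Real.log (128 * B) / (49 * B / 50) + Real.log (2 * B) / (49 * B / 50) +
            Real.log B / (49 * B / 50) := by
        rw [hlog128, hlog2B]; ring
      rw [e]; linarith
    have h2 := mul_le_mul_of_nonneg_left h1 hB0.le
    have e : B * ((8 * Real.log 2 + 3 * Real.log B) / (49 * B / 50)) =
        50 / 49 * (8 * Real.log 2 + 3 * Real.log B) := by
      field_simp
    linarith
  refine ⟨σm, hσm0, hσmT, hint, fun σ hσ => (hpart2 σ hσ).1, hT3, hBT, huT, hbT, hβT, ?_⟩
  have hlog := pulse_log_le hB
  have h2 := Real.log_two_lt_d9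
  nlinarith

/-- **Registered sub-goal `stub_pulseExit` of the stub `pulse`** (closed form of
`pulse_gate_exit`): the exit data of a gate phase ending at `w T = 1`. [folklore] -/
theorem stub_pulseExit :
    ∀ (b w β f₁ f₂ f₃ R u : ℝ → ℝ) (B q4 φ σ₁ T : ℝ),
      10 ^ 4 ≤ B → 1 ≤ q4 → q4 ≤ 111 / 100 → 0 ≤ φ → φ ≤ 1 / 2000 → σ₁ ≤ 1 / 10 →
      ContinuousOn b (Icc 0 σ₁) → ContinuousOn w (Icc 0 σ₁) → ContinuousOn β (Icc 0 σ₁) →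
      (∀ σ ∈ Ioo 0 σ₁, HasDerivAt b (-(b σ) - (w σ) ^ 2 + f₁ σ) σ) →
      (∀ σ ∈ Ioo 0 σ₁, HasDerivAt w (w σ * (b σ - β σ - 1) + f₂ σ) σ) →
      (∀ σ ∈ Ioo 0 σ₁, HasDerivAt β (-(q4 * β σ) + (w σ) ^ 2 + f₃ σ) σ) →
      (∀ σ ∈ Icc 0 σ₁, |f₁ σ| ≤ φ ∧ |f₂ σ| ≤ φ ∧ |f₃ σ| ≤ φ) → b 0 = B → w 0 = Real.sqrt B / 10 →
      |β 0| ≤ 1 / 50 → (R = fun s => Real.sqrt ((b s - β s) ^ 2 + 2 * (w s) ^ 2)) →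
      (u = fun s => (b s - β s) / R s) → 0 < T → T ≤ σ₁ → B * T ≤ 5 * Real.log B + 20 →
      (∀ σ ∈ Icc 0 T, 1 ≤ w σ) → w T = 1 →
      ∃ σm : ℝ, 0 < σm ∧ σm ≤ T ∧
        49 * B / 50 * ∫ σ in (0 : ℝ)..σm, (1 - u σ) ≤ 1 + T / (1000 * B) ∧
        (∀ σ ∈ Icc (σm + Real.log (2 * B) / (49 * B / 50)) T,
          -(q4 * β σ) + (w σ) ^ 2 + f₃ σ < 0) ∧
        T < σm + Real.log (2 * B) / (49 * B / 50) + Real.log B / (49 * B / 50) ∧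
        B * T ≤ 50 / 49 * (8 * Real.log 2 + 3 * Real.log B) ∧
        u T ≤ 0 ∧ b T ≤ 83 / 5000 ∧ B - 1 / 50 - 11111 / 10000 * B * T - 1 / 10000 ≤ β T ∧
        996 / 1000 * B ≤ β T  :=
  fun b w β f₁ f₂ f₃ R u B q4 φ σ₁ T hB hq1 hq2 hφ0 hφ1 hσ₁ hbc hwc hβc hbd hwd hβd hf hb0 hw0 hβ0
      hR hu hT0 hT1 hTB hw1 hwT =>
    pulse_gate_exit b w β f₁ f₂ f₃ R u B q4 φ σ₁ T hB hq1 hq2 hφ0 hφ1 hσ₁ hbc hwc hβc hbd hwd hβd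
      hf hb0 hw0 hβ0 hR hu hT0 hT1 hTB hw1 hwT

end Summit.NavierStokesRegularity.NavierStokesRegularity.Theorems.PerpetualPumpAveragedTypeIBlowup

end
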